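import Literature.Analysis.ODE.RadiationField1D
import Literature.Analysis.ODE.RadiationProfileIntegrals1D
import Literature.Analysis.Calculus.TwoVariablePartials
import HarnessLib

/-!
# Radiation fields on the line, II: the energy identities of a radiation-field representation

Topic `Literature/Analysis/ODE` (namespace `Literature.Analysis.ODE.Scattering1D`), continuation of
`RadiationField1D.lean`; everything PROVED.  Let `ψ` be `C²` on `ℝ²`, `V ≥ 0` continuous, and let
`(G₊, G₋)` be a radiation-field representation of `ψ` (`RadiationFieldRepresentation1D V ψ G₊ G₋`:
`G± ∈ L²` and the radiation defect tends to `0` as `t → +∞`).  Then, in the vocabulary of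
`Literature.Geometry.Lorentzian.ReggeWheelerChannels`:

* `tendsto_totalEnergy` — `totalEnergy V ψ t → 2‖G₊‖₂² + 2‖G₋‖₂²` (`= profileEnergy G₊ univ +
  profileEnergy G₋ univ`); with energy conservation as a hypothesis, `totalEnergy V ψ 0` equals it
  (`totalEnergy_eq_of_conserved`) — "the radiation fields carry all the energy";
* `tendsto_exteriorEnergy`, `channelEnergy_atTop_eq` — for every centre `xc` and aperture `ρ`
  (any sign), `exteriorEnergy V xc ρ ψ t → 2∫_{u < −(ρ + xc)} G₊² + 2∫_{v < xc − ρ} G₋²`, hence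
  `channelEnergy V xc ρ ψ atTop = profileEnergy G₊ (Iio (−(ρ + xc))) + profileEnergy G₋ (Iio (xc − ρ))`:
  the forward channel energy is the radiation emitted before the retarded / advanced times set by
  the cone's edges;
* `tendsto_farEnergy`, `farChannelEnergy_atTop_eq` — the one-ended version
  `farChannelEnergy V xe ψ atTop = profileEnergy G₊ (Iio (−xe))`.

Mechanism (`tendsto_setLIntegral_energyDensity`): at each time the energy of `ψ` on a measurable set
`S(t)` and the free energy `∫_{S(t)} 2G₊(t−x)² + 2G₋(t+x)²` have square roots differing by at most
`√defect(t)` (Minkowski in `L²`, `ENNReal.lintegral_Lp_add_le`, applied to the pointwise triangle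
inequality for `(ψ_t, ψ_x, √V ψ)` against `(∂ₜΦ, ∂ₓΦ, 0)`); the free energies are computed by the
substitutions `u = t − x`, `v = t + x`, and tails `∫_{u > c(t)} G²` with `c(t) → ∞` vanish (toolkit
`RadiationProfileIntegrals1D.lean`).  The backward-in-time identities are these applied to
`ψ(−t, x)`.

## References
* P. D. Lax, R. S. Phillips, *Scattering Theory* (1967), Ch. I §5 (energy of the string through its
  translation representers, (5.9)). Key `LaxPhillips1967`.
* C. Kenig, A. Lawrie, B. Liu, W. Schlag, Adv. Math. 285 (2015), §§2–3 (exterior energy through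
  radiation profiles, flat radial case). Key `KenigEtAl2015`.
-/

noncomputable section

open Set Filter MeasureTheory
open scoped ENNReal Topology

namespace Literature.Analysis.ODE

namespace Scattering1D

open Literature.Geometry.Lorentzian.ReggeWheeler

/-! ### The toolkit in `profileEnergy` notation

(Vanishing of the tails `profileEnergy G (Ioi (c t))` along a divergent cut-off `c` is
`tendsto_tail_two_mul_sq_comp` of `RadiationProfileIntegrals1D.lean`, used directly: `profileEnergy`
unfolds to the set integral there.) -/

/-- `∫_{x > c} 2G(t − x)² dx = profileEnergy G {u < t − c}`. [folklore] -/
theorem profileEnergy_Ioi_sub (G : ℝ → ℝ) (t c : ℝ) :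
    ∫⁻ x in Ioi c, ENNReal.ofReal (2 * G (t - x) ^ 2) = profileEnergy G (Iio (t - c)) :=
  setLIntegral_Ioi_profile_sub G t c

/-- `∫_{x < c} 2G(t − x)² dx = profileEnergy G {u > t − c}`. [folklore] -/
theorem profileEnergy_Iio_sub (G : ℝ → ℝ) (t c : ℝ) :
    ∫⁻ x in Iio c, ENNReal.ofReal (2 * G (t - x) ^ 2) = profileEnergy G (Ioi (t - c)) :=
  setLIntegral_Iio_profile_sub G t c

/-- `∫_{x > c} 2G(t + x)² dx = profileEnergy G {v > t + c}`. [folklore] -/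
theorem profileEnergy_Ioi_add (G : ℝ → ℝ) (t c : ℝ) :
    ∫⁻ x in Ioi c, ENNReal.ofReal (2 * G (t + x) ^ 2) = profileEnergy G (Ioi (t + c)) :=
  setLIntegral_Ioi_profile_add G t c

/-- `∫_{x < c} 2G(t + x)² dx = profileEnergy G {v < t + c}`. [folklore] -/
theorem profileEnergy_Iio_add (G : ℝ → ℝ) (t c : ℝ) :
    ∫⁻ x in Iio c, ENNReal.ofReal (2 * G (t + x) ^ 2) = profileEnergy G (Iio (t + c)) :=
  setLIntegral_Iio_profile_add G t c

/-- `∫ 2G(t − x)² dx = profileEnergy G univ`. [folklore] -/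
theorem profileEnergy_univ_sub (G : ℝ → ℝ) (t : ℝ) :
    ∫⁻ x, ENNReal.ofReal (2 * G (t - x) ^ 2) = profileEnergy G univ := by
  rw [lintegral_profile_sub, profileEnergy, Measure.restrict_univ]

/-- `∫ 2G(t + x)² dx = profileEnergy G univ`. [folklore] -/
theorem profileEnergy_univ_add (G : ℝ → ℝ) (t : ℝ) :
    ∫⁻ x, ENNReal.ofReal (2 * G (t + x) ^ 2) = profileEnergy G univ := by
  rw [lintegral_profile_add, profileEnergy, Measure.restrict_univ]

/-! ### The energy of `ψ` on moving sets follows the free energy -/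

section Main

variable {V : ℝ → ℝ} {ψ : ℝ → ℝ → ℝ} {Gp Gm : ℝ → ℝ}

/-- The free energy density of the profile pair, `2G₊(t − x)² + 2G₋(t + x)²`, is a.e.-measurable in
`x`. [folklore] -/
theorem aemeasurable_freeDensity (hGp : AEStronglyMeasurable Gp volume)
    (hGm : AEStronglyMeasurable Gm volume) (t : ℝ) :
    AEMeasurable (fun x ↦ 2 * Gp (t - x) ^ 2 + 2 * Gm (t + x) ^ 2) volume :=
  (((aemeasurable_comp_sub hGp t).pow_const 2).const_mul 2).add
    (((aemeasurable_comp_add hGm t).pow_const 2).const_mul 2)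

/-- **Core estimate and limit.** Let `(G₊, G₋)` represent `ψ` (`C²`, `V ≥ 0` continuous).  If along
measurable sets `S(t)` the FREE energies `∫_{S(t)} 2G₊(t−x)² + 2G₋(t+x)² dx` tend to `L`, then so do
the energies `∫_{S(t)} e[ψ](t, x) dx`. [folklore] -/
theorem RadiationFieldRepresentation1D.tendsto_setLIntegral_energyDensity
    (h : RadiationFieldRepresentation1D V ψ Gp Gm) (hV : Continuous V) (hV0 : ∀ x, 0 ≤ V x)
    (hψ : ContDiff ℝ 2 (Function.uncurry ψ)) {S : ℝ → Set ℝ} {L : ℝ≥0∞}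
    (hP : Tendsto (fun t ↦ ∫⁻ x in S t, ENNReal.ofReal (2 * Gp (t - x) ^ 2 + 2 * Gm (t + x) ^ 2))
      atTop (𝓝 L)) :
    Tendsto (fun t ↦ ∫⁻ x in S t, ENNReal.ofReal (energyDensity V ψ t x)) atTop (𝓝 L) := by
  obtain ⟨ψt, ψx, -, -, -, hct, hcx, -, -, -, h1, h2, -⟩ :=
    Literature.Analysis.Calculus.exists_partials_of_contDiff_two hψ
  have hd1 : ∀ t x, deriv (fun τ ↦ ψ τ x) t = ψt t x := fun t x ↦ (h1 t x).deriv
  have hd2 : ∀ t x, deriv (ψ t) x = ψx t x := fun t x ↦ (h2 t x).deriv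
  -- the three nonnegative densities at time `t`
  set e : ℝ → ℝ → ℝ := fun t x ↦ energyDensity V ψ t x with he
  set p : ℝ → ℝ → ℝ := fun t x ↦ 2 * Gp (t - x) ^ 2 + 2 * Gm (t + x) ^ 2 with hp
  set d : ℝ → ℝ → ℝ := fun t x ↦ (deriv (fun τ ↦ ψ τ x) t - freeVelocity Gp Gm t x) ^ 2 +
    (deriv (ψ t) x - freeGradient Gp Gm t x) ^ 2 + V x * ψ t x ^ 2 with hd
  have he0 : ∀ t x, 0 ≤ e t x := fun t x ↦ energyDensity_nonneg ψ t (hV0 x)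
  have hp0 : ∀ t x, 0 ≤ p t x := fun t x ↦ by positivity
  have hd0 : ∀ t x, 0 ≤ d t x := fun t x ↦ by have := hV0 x; positivity
  -- pointwise triangle inequalities for `(ψ_t, ψ_x, √V ψ) = (∂ₜΦ, ∂ₓΦ, 0) + (δ₁, δ₂, √V ψ)`
  have hsq : ∀ t x, e t x = (freeVelocity Gp Gm t x + (deriv (fun τ ↦ ψ τ x) t -
      freeVelocity Gp Gm t x)) ^ 2 + (freeGradient Gp Gm t x + (deriv (ψ t) x -
      freeGradient Gp Gm t x)) ^ 2 + (0 + Real.sqrt (V x) * ψ t x) ^ 2 := fun t x ↦ by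
    simp only [he, energyDensity, zero_add, mul_pow, Real.sq_sqrt (hV0 x)]
    ring
  have hpq : ∀ t x, p t x = freeVelocity Gp Gm t x ^ 2 + freeGradient Gp Gm t x ^ 2 + (0 : ℝ) ^ 2 :=
    fun t x ↦ by simp only [hp, freeVelocity_sq_add_freeGradient_sq]; ring
  have hdd : ∀ t x, d t x = (deriv (fun τ ↦ ψ τ x) t - freeVelocity Gp Gm t x) ^ 2 +
      (deriv (ψ t) x - freeGradient Gp Gm t x) ^ 2 + (Real.sqrt (V x) * ψ t x) ^ 2 := fun t x ↦ by
    simp only [hd, mul_pow, Real.sq_sqrt (hV0 x)]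
  have htri1 : ∀ t x, Real.sqrt (e t x) ≤ Real.sqrt (d t x) + Real.sqrt (p t x) := fun t x ↦ by
    rw [hsq, hpq, hdd, add_comm (Real.sqrt _)]
    exact sqrt_sum_sq_add_le _ _ _ _ _ _
  have htri2 : ∀ t x, Real.sqrt (p t x) ≤ Real.sqrt (d t x) + Real.sqrt (e t x) := fun t x ↦ by
    have h' := sqrt_sum_sq_add_le (deriv (fun τ ↦ ψ τ x) t) (deriv (ψ t) x)
      (Real.sqrt (V x) * ψ t x) (-(deriv (fun τ ↦ ψ τ x) t - freeVelocity Gp Gm t x))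
      (-(deriv (ψ t) x - freeGradient Gp Gm t x)) (-(Real.sqrt (V x) * ψ t x))
    have e1 : (deriv (fun τ ↦ ψ τ x) t + -(deriv (fun τ ↦ ψ τ x) t - freeVelocity Gp Gm t x)) ^ 2 +
        (deriv (ψ t) x + -(deriv (ψ t) x - freeGradient Gp Gm t x)) ^ 2 +
        (Real.sqrt (V x) * ψ t x + -(Real.sqrt (V x) * ψ t x)) ^ 2 = p t x := by
      rw [hpq]; ring
    have e2 : deriv (fun τ ↦ ψ τ x) t ^ 2 + deriv (ψ t) x ^ 2 + (Real.sqrt (V x) * ψ t x) ^ 2 =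
        e t x := by rw [hsq]; ring
    have e3 : (-(deriv (fun τ ↦ ψ τ x) t - freeVelocity Gp Gm t x)) ^ 2 +
        (-(deriv (ψ t) x - freeGradient Gp Gm t x)) ^ 2 + (-(Real.sqrt (V x) * ψ t x)) ^ 2 =
        d t x := by rw [hdd]; ring
    rw [e1, e2, e3] at h'
    rwa [add_comm] at h'
  -- measurability
  have hem : ∀ t, AEMeasurable (e t) volume := fun t ↦ by
    have hc : Continuous (e t) := by
      simp only [he, energyDensity, hd1, hd2]
      have ha : Continuous fun x ↦ ψt t x := hct.comp (continuous_const.prodMk continuous_id)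
      have hb : Continuous fun x ↦ ψx t x := hcx.comp (continuous_const.prodMk continuous_id)
      have hc' : Continuous fun x ↦ ψ t x := hψ.continuous.comp (continuous_const.prodMk continuous_id)
      fun_prop
    exact hc.aemeasurable
  have hpm : ∀ t, AEMeasurable (p t) volume := fun t ↦
    aemeasurable_freeDensity h.memLp_right.1 h.memLp_left.1 t
  have hdm : ∀ t, AEMeasurable (d t) volume := fun t ↦ by
    simp only [hd, hd1, hd2, freeVelocity, freeGradient]
    have ha : Continuous fun x ↦ ψt t x := hct.comp (continuous_const.prodMk continuous_id)
    have hb : Continuous fun x ↦ ψx t x := hcx.comp (continuous_const.prodMk continuous_id)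
    have hc' : Continuous fun x ↦ ψ t x := hψ.continuous.comp (continuous_const.prodMk continuous_id)
    have h3 := aemeasurable_comp_sub h.memLp_right.1 t
    have h4 := aemeasurable_comp_add h.memLp_left.1 t
    exact (((ha.aemeasurable.sub (h3.add h4)).pow_const 2).add
      ((hb.aemeasurable.sub (h3.neg.add h4)).pow_const 2)).add
      (hV.aemeasurable.mul ((hc'.aemeasurable).pow_const 2))
  -- the two Minkowski bounds, on `S t`
  have hD : Tendsto (fun t ↦ ∫⁻ x in S t, ENNReal.ofReal (d t x)) atTop (𝓝 0) := by
    refine tendsto_of_tendsto_of_tendsto_of_le_of_le' tendsto_const_nhds h.tendsto_radiationDefect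
      (Eventually.of_forall fun t ↦ bot_le) (Eventually.of_forall fun t ↦ ?_)
    exact setLIntegral_le_lintegral _ _
  refine tendsto_of_rpow_half_bounds (D := fun t ↦ ∫⁻ x in S t, ENNReal.ofReal (d t x))
    (P := fun t ↦ ∫⁻ x in S t, ENNReal.ofReal (p t x)) ?_ ?_ hD hP
  · exact Eventually.of_forall fun t ↦ lintegral_rpow_half_le_add (he0 t) (hd0 t) (hp0 t)
      (htri1 t) (hdm t).restrict (hpm t).restrict
  · exact Eventually.of_forall fun t ↦ lintegral_rpow_half_le_add (hp0 t) (hd0 t) (he0 t)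
      (htri2 t) (hdm t).restrict (hem t).restrict

/-- **The radiation fields carry all the energy, asymptotically**: `totalEnergy V ψ t →
2‖G₊‖₂² + 2‖G₋‖₂²` as `t → +∞` (the energy identity of the translation representation,
Lax–Phillips Ch. I §5 (5.9), transported along the defect). [folklore] -/
theorem RadiationFieldRepresentation1D.tendsto_totalEnergy (h : RadiationFieldRepresentation1D V ψ Gp Gm)
    (hV : Continuous V) (hV0 : ∀ x, 0 ≤ V x) (hψ : ContDiff ℝ 2 (Function.uncurry ψ)) :
    Tendsto (totalEnergy V ψ) atTop (𝓝 (profileEnergy Gp univ + profileEnergy Gm univ)) := by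
  have hP : Tendsto (fun t ↦ ∫⁻ x in (univ : Set ℝ),
      ENNReal.ofReal (2 * Gp (t - x) ^ 2 + 2 * Gm (t + x) ^ 2)) atTop
      (𝓝 (profileEnergy Gp univ + profileEnergy Gm univ)) := by
    refine tendsto_const_nhds.congr fun t ↦ ?_
    rw [Measure.restrict_univ, ← profileEnergy_univ_sub Gp t, ← profileEnergy_univ_add Gm t,
      ← lintegral_add_left' (((aemeasurable_comp_sub h.memLp_right.1 t).pow_const 2).const_mul
        2).ennreal_ofReal]
    refine lintegral_congr fun x ↦ ?_
    rw [ENNReal.ofReal_add (by positivity) (by positivity)]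
  have := h.tendsto_setLIntegral_energyDensity hV hV0 hψ (S := fun _ ↦ univ) hP
  simp only [Measure.restrict_univ] at this
  exact this.congr fun t ↦ rfl

/-- With energy conservation (a theorem about solutions, taken here as the hypothesis `hcons`),
**`totalEnergy V ψ 0 = 2‖G₊‖₂² + 2‖G₋‖₂²`** — asymptotic completeness for `ψ` in the form used by
the channel items. [folklore] -/
theorem RadiationFieldRepresentation1D.totalEnergy_eq_of_conserved
    (h : RadiationFieldRepresentation1D V ψ Gp Gm) (hV : Continuous V) (hV0 : ∀ x, 0 ≤ V x)
    (hψ : ContDiff ℝ 2 (Function.uncurry ψ)) (hcons : ∀ t, totalEnergy V ψ t = totalEnergy V ψ 0) :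
    totalEnergy V ψ 0 = profileEnergy Gp univ + profileEnergy Gm univ :=
  tendsto_nhds_unique (tendsto_const_nhds.congr fun t ↦ (hcons t).symm)
    (h.tendsto_totalEnergy hV hV0 hψ)

/-- **Free energy through the exterior channel.** For `t ≥ max 0 (−ρ)` the free energy on
`{ρ + |t| < |x − xc|}` is `∫_{u<−(ρ+xc)} 2G₊² + ∫_{v<xc−ρ} 2G₋²` plus the two tails
`∫_{v > xc+ρ+2t} 2G₋² + ∫_{u > 2t+ρ−xc} 2G₊²`. [folklore] -/
theorem setLIntegral_exterior_freeDensity (hGp : AEStronglyMeasurable Gp volume) (xc ρ : ℝ) {t : ℝ}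
    (ht0 : 0 ≤ t) (hρt : 0 ≤ ρ + t) :
    ∫⁻ x in {x : ℝ | ρ + |t| < |x - xc|}, ENNReal.ofReal (2 * Gp (t - x) ^ 2 + 2 * Gm (t + x) ^ 2) =
      profileEnergy Gp (Iio (-(ρ + xc))) + profileEnergy Gm (Iio (xc - ρ)) +
        (profileEnergy Gm (Ioi (xc + ρ + 2 * t)) + profileEnergy Gp (Ioi (2 * t + ρ - xc))) := by
  have hset : {x : ℝ | ρ + |t| < |x - xc|} = Ioi (xc + ρ + t) ∪ Iio (xc - ρ - t) := by
    ext x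
    simp only [mem_setOf_eq, mem_union, mem_Ioi, mem_Iio, abs_of_nonneg ht0]
    rw [lt_abs]
    constructor
    · rintro (h1 | h1)
      · left; linarith
      · right; linarith
    · rintro (h1 | h1)
      · left; linarith
      · right; linarith
  have hdisj : Disjoint (Ioi (xc + ρ + t)) (Iio (xc - ρ - t)) := by
    rw [Set.disjoint_iff]
    rintro x ⟨h1, h2⟩
    simp only [mem_Ioi, mem_Iio] at h1 h2
    linarith
  have hsplit : ∀ s : Set ℝ, ∫⁻ x in s, ENNReal.ofReal (2 * Gp (t - x) ^ 2 + 2 * Gm (t + x) ^ 2) =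
      (∫⁻ x in s, ENNReal.ofReal (2 * Gp (t - x) ^ 2)) +
        ∫⁻ x in s, ENNReal.ofReal (2 * Gm (t + x) ^ 2) := fun s ↦ by
    rw [← lintegral_add_left' (((aemeasurable_comp_sub hGp t).pow_const 2).const_mul
        2).ennreal_ofReal.restrict]
    refine lintegral_congr fun x ↦ ?_
    rw [ENNReal.ofReal_add (by positivity) (by positivity)]
  rw [hset, lintegral_union measurableSet_Iio hdisj, hsplit, hsplit,
    profileEnergy_Ioi_sub, profileEnergy_Ioi_add, profileEnergy_Iio_sub,
    profileEnergy_Iio_add]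
  have e1 : t - (xc + ρ + t) = -(ρ + xc) := by ring
  have e2 : t + (xc + ρ + t) = xc + ρ + 2 * t := by ring
  have e3 : t - (xc - ρ - t) = 2 * t + ρ - xc := by ring
  have e4 : t + (xc - ρ - t) = xc - ρ := by ring
  rw [e1, e2, e3, e4]
  ring

/-- **Exterior energy through the radiation fields**: for every centre `xc` and aperture `ρ`,
`exteriorEnergy V xc ρ ψ t → ∫_{u < −(ρ+xc)} 2G₊² + ∫_{v < xc−ρ} 2G₋²` as `t → +∞` (the
one-dimensional analogue of the exterior-energy computation through radiation profiles of
Kenig–Lawrie–Liu–Schlag §2). [folklore] -/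
theorem RadiationFieldRepresentation1D.tendsto_exteriorEnergy
    (h : RadiationFieldRepresentation1D V ψ Gp Gm) (hV : Continuous V) (hV0 : ∀ x, 0 ≤ V x)
    (hψ : ContDiff ℝ 2 (Function.uncurry ψ)) (xc ρ : ℝ) :
    Tendsto (exteriorEnergy V xc ρ ψ) atTop
      (𝓝 (profileEnergy Gp (Iio (-(ρ + xc))) + profileEnergy Gm (Iio (xc - ρ)))) := by
  set L := profileEnergy Gp (Iio (-(ρ + xc))) + profileEnergy Gm (Iio (xc - ρ)) with hL
  have htail : Tendsto (fun t ↦ profileEnergy Gm (Ioi (xc + ρ + 2 * t)) +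
      profileEnergy Gp (Ioi (2 * t + ρ - xc))) atTop (𝓝 0) := by
    have h1 : Tendsto (fun t : ℝ ↦ xc + ρ + 2 * t) atTop atTop :=
      tendsto_atTop_add_const_left _ _ (Tendsto.const_mul_atTop two_pos tendsto_id)
    have h2 : Tendsto (fun t : ℝ ↦ 2 * t + ρ - xc) atTop atTop :=
      tendsto_atTop_add_const_right _ _ (tendsto_atTop_add_const_right _ _
        (Tendsto.const_mul_atTop two_pos tendsto_id))
    have h1' : Tendsto (fun t ↦ profileEnergy Gm (Ioi (xc + ρ + 2 * t))) atTop (𝓝 0) :=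
      tendsto_tail_two_mul_sq_comp h.memLp_left h1
    have h2' : Tendsto (fun t ↦ profileEnergy Gp (Ioi (2 * t + ρ - xc))) atTop (𝓝 0) :=
      tendsto_tail_two_mul_sq_comp h.memLp_right h2
    simpa using h1'.add h2'
  have hP : Tendsto (fun t ↦ ∫⁻ x in {x : ℝ | ρ + |t| < |x - xc|},
      ENNReal.ofReal (2 * Gp (t - x) ^ 2 + 2 * Gm (t + x) ^ 2)) atTop (𝓝 L) := by
    have hlim : Tendsto (fun t ↦ L + (profileEnergy Gm (Ioi (xc + ρ + 2 * t)) +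
        profileEnergy Gp (Ioi (2 * t + ρ - xc)))) atTop (𝓝 L) := by
      simpa using htail.const_add L
    refine hlim.congr' ?_
    filter_upwards [eventually_ge_atTop (max 0 (-ρ))] with t ht
    rw [setLIntegral_exterior_freeDensity h.memLp_right.1 xc ρ (le_of_max_le_left ht)
      (by have := le_of_max_le_right ht; linarith)]
  exact h.tendsto_setLIntegral_energyDensity hV hV0 hψ hP

/-- **The forward channel energy is the windowed radiation**: for every `xc`, `ρ`,
`channelEnergy V xc ρ ψ atTop = ∫_{u < −(ρ+xc)} 2G₊² + ∫_{v < xc−ρ} 2G₋²`; for the centred channel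
(`xc = 0`) this is `2∫_{u<−ρ} G₊² + 2∫_{v<−ρ} G₋²`. [folklore] -/
theorem RadiationFieldRepresentation1D.channelEnergy_atTop_eq
    (h : RadiationFieldRepresentation1D V ψ Gp Gm) (hV : Continuous V) (hV0 : ∀ x, 0 ≤ V x)
    (hψ : ContDiff ℝ 2 (Function.uncurry ψ)) (xc ρ : ℝ) :
    channelEnergy V xc ρ ψ atTop =
      profileEnergy Gp (Iio (-(ρ + xc))) + profileEnergy Gm (Iio (xc - ρ)) :=
  (h.tendsto_exteriorEnergy hV hV0 hψ xc ρ).liminf_eq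

/-- **Far (one-ended) energy through the right radiation field**:
`farEnergy V xe ψ t → ∫_{u < −xe} 2G₊²` as `t → +∞`. [folklore] -/
theorem RadiationFieldRepresentation1D.tendsto_farEnergy
    (h : RadiationFieldRepresentation1D V ψ Gp Gm) (hV : Continuous V) (hV0 : ∀ x, 0 ≤ V x)
    (hψ : ContDiff ℝ 2 (Function.uncurry ψ)) (xe : ℝ) :
    Tendsto (farEnergy V xe ψ) atTop (𝓝 (profileEnergy Gp (Iio (-xe)))) := by
  have htail : Tendsto (fun t ↦ profileEnergy Gm (Ioi (t + (xe + t)))) atTop (𝓝 0) := by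
    refine tendsto_tail_two_mul_sq_comp (c := fun t ↦ t + (xe + t)) h.memLp_left ?_
    have : Tendsto (fun t : ℝ ↦ 2 * t + xe) atTop atTop :=
      tendsto_atTop_add_const_right _ _ (Tendsto.const_mul_atTop two_pos tendsto_id)
    exact this.congr fun t ↦ by ring
  have hP : Tendsto (fun t ↦ ∫⁻ x in {x : ℝ | xe + |t| < x},
      ENNReal.ofReal (2 * Gp (t - x) ^ 2 + 2 * Gm (t + x) ^ 2)) atTop
      (𝓝 (profileEnergy Gp (Iio (-xe)))) := by
    have hlim : Tendsto (fun t ↦ profileEnergy Gp (Iio (-xe)) + profileEnergy Gm (Ioi (t + (xe + t))))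
        atTop (𝓝 (profileEnergy Gp (Iio (-xe)))) := by
      simpa using htail.const_add (profileEnergy Gp (Iio (-xe)))
    refine hlim.congr' ?_
    filter_upwards [eventually_ge_atTop (0 : ℝ)] with t ht
    have hset : {x : ℝ | xe + |t| < x} = Ioi (xe + t) := by
      ext x; simp [abs_of_nonneg ht]
    have e : ∫⁻ x in Ioi (xe + t), ENNReal.ofReal (2 * Gp (t - x) ^ 2 + 2 * Gm (t + x) ^ 2) =
        ∫⁻ x in Ioi (xe + t), ENNReal.ofReal (2 * Gp (t - x) ^ 2) + ENNReal.ofReal (2 * Gm (t + x) ^ 2) :=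
      lintegral_congr fun x ↦ by rw [ENNReal.ofReal_add (by positivity) (by positivity)]
    rw [hset, e, lintegral_add_left' (((aemeasurable_comp_sub h.memLp_right.1 t).pow_const
        2).const_mul 2).ennreal_ofReal.restrict, profileEnergy_Ioi_sub,
      profileEnergy_Ioi_add]
    have e' : t - (xe + t) = -xe := by ring
    rw [e']
  exact h.tendsto_setLIntegral_energyDensity hV hV0 hψ hP

/-- **The forward far channel energy is the right radiation emitted before retarded time `−xe`**:
`farChannelEnergy V xe ψ atTop = ∫_{u < −xe} 2G₊²`. [folklore] -/
theorem RadiationFieldRepresentation1D.farChannelEnergy_atTop_eq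
    (h : RadiationFieldRepresentation1D V ψ Gp Gm) (hV : Continuous V) (hV0 : ∀ x, 0 ≤ V x)
    (hψ : ContDiff ℝ 2 (Function.uncurry ψ)) (xe : ℝ) :
    farChannelEnergy V xe ψ atTop = profileEnergy Gp (Iio (-xe)) :=
  (h.tendsto_farEnergy hV hV0 hψ xe).liminf_eq

end Main

end Scattering1D

end Literature.Analysis.ODE
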